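import Mathlib
import Summits.BirchSwinnertonDyer.BirchSwinnertonDyer.Theorems.ManinLocalTwoThreeTauThreeOrbits
import HarnessLib

/-!
# E-an-46 `ThreeDvdModularDegreeOfCuspImageZero` HOLDS: at `4 ∥ N`, if the cusp `1/M` maps to `O` then `3 ∣ deg φ`
# — by fibre counting on `deg_spec` with a COUNTABILITY argument (no Riemann–Hurwitz, no fixed-point finiteness)

Summit `BirchSwinnertonDyer`, sub-problem `BirchSwinnertonDyer`, route `ManinLocalTwoThree`; width seat `bsd-line-manin23-p2`
(gen 8), `--supports` the crux C2 `ManinOddAtFour` (stmt-BirchSwinnertonDyer-22967).  Cell `bsd-f2-manin`, analytic lens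
(an g11, MEMO-an §55: the `S₃`-at-`4` package E-an-44/45/45′/46/46′; refuter-1 §R46: «E-an-46 THEOREM-candidate by the
fibre-counting proof B.5 on `deg_spec`»; an g18/g22 deferred it as «needs τ-fixed-point finiteness on `Y₀(N)` — XL»).  This file
proves it, replacing FINITENESS of the fixed points of `τ₃` by their COUNTABILITY, which is elementary, and using that `E(ℂ)` is
uncountable.

THE ARGUMENT.  `N = 4M`, `M` odd, `D` any parametrisation datum of any `W`, `τ₃ := w(4)·t ∈ GL₂⁺(ℚ)` (`t = (2 1; 0 2)`).
1. `2πi∫_{i∞}^{τ₃ z} f = 2πi∫_{i∞}^{z} f + {∞, x/M}_f` (`eichlerIntegral_tau3_smul`: the tree's `eichlerIntegral_atkinLehnerW_smul`,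
   `w₄ f = −f` = the seat's E-an-44 `atkinLehnerInvolution_four_eq_neg`, and `f ∣ t = −f`), and `{∞,x/M} ≡ {∞,1/M} (mod Λ_f)`;
   so `φ_D(τ₃ z) = φ_D(z) + φ_D([1/M])`, i.e. **`φ_D ∘ τ₃ = φ_D` under the row's hypothesis** (`φ_tau3_smul`).
2. `τ₃` normalises `Γ₀(4M)` and `τ₃³ = 64·γ₀`, `γ₀ ∈ Γ₀(4M)` (the seat's `atkinLehnerW_mul_halfTranslateGL_cube`): `τ₃` permutes
   `Y₀(4M)` with cube the identity (`Y0_mk_smul_eq_of_mk_eq`, `Y0_mk_tau3_cube`), hence permutes every fibre of `φ_D`.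
3. A Möbius transformation of positive determinant with TWO fixed points in `ℍ` is scalar (`scalar_of_two_fixedPoints`, Vieta);
   `γ⁻¹τ₃` is never scalar for `γ ∈ Γ₀(4M)` (it would force `γ₁₀ = ±2M`, but `4M ∣ γ₁₀`), so each equation `γ z = τ₃ z` has at most
   one solution and **the set of `z ∈ ℍ` with `τ₃`-fixed orbit is countable** (`countable_setOf_exists_gamma_smul_eq_tau3_smul`).
4. `E(ℂ)` is uncountable (`not_countable_univ_points`: `ℂ ↠ E(ℂ)` with kernel `Λ_W ≅ ℤ²`), so some `P` avoids the images of
   those `z` and the finite exceptional set of `deg_spec`; on its fibre (of size `deg φ_D`) `τ₃` acts as a fixed-point-free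
   permutation `σ` with `σ³ = 1`, and `Equiv.Perm.card_fixedPoints_modEq` (`p = 3`) gives `deg φ_D ≡ 0 (mod 3)`.

PROVED: **`threeDvdModularDegreeOfCuspImageZero_holds : ThreeDvdModularDegreeOfCuspImageZero`** (E-an-46 BY NAME) and the
tools above.  E-an-46′ (`ThreeDvdModularDegreeAtFourExact`, the torsion form) still needs «`φ_D` is defined over `ℚ`» (refuter-1
§R46 B.6: a typing gap) and is NOT claimed here.  BSD is not proved by this; Manin's conjecture is not proved by this.
-/

set_option autoImplicit false
-- `Summit.BirchSwinnertonDyer.BirchSwinnertonDyer` is the mandated summit-side namespace (single-conjunct summit).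
set_option linter.dupNamespace false

noncomputable section

open scoped MatrixGroups ModularForm
open CongruenceSubgroup Matrix.SpecialLinearGroup UpperHalfPlane
open Literature.NumberTheory.EllipticCurves Literature.NumberTheory.EllipticCurves.ModularForms
open Summit.BirchSwinnertonDyer.Rank1Residual.ManinAdditive
open Summit.BirchSwinnertonDyer.Rank1Residual.ManinAdditive.ConwayCut

namespace Summit.BirchSwinnertonDyer.BirchSwinnertonDyer.Theorems.ManinLocalTwoThree

/-! ### `E(ℂ)` is uncountable -/

/-- **`E(ℂ)` is uncountable**: the uniformisation `ℂ ↠ E(ℂ)` has the countable lattice `Λ_W ≅ ℤ²` as kernel. -/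
theorem not_countable_univ_points {W : WeierstrassCurve ℚ} {N : ℕ} [NeZero N] (D : ModularParametrizationData W N) :
    ¬ (Set.univ : Set (W.baseChange ℂ).toAffine.Point).Countable := by
  intro hc
  haveI : Countable (Set.univ : Set (W.baseChange ℂ).toAffine.Point) := hc.to_subtype
  haveI : Countable D.L.lattice := Countable.of_equiv _ D.L.latticeEquivProd.toEquiv.symm
  have hlat : (D.L.lattice : Set ℂ).Countable := Set.countable_coe_iff.mp inferInstance
  -- every `z` lies in `z_P + Λ` for `P = uniformize z`
  have hcover : (Set.univ : Set ℂ) ⊆ ⋃ P : (Set.univ : Set (W.baseChange ℂ).toAffine.Point),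
      (fun l : ℂ => Function.surjInv D.uniformize_surjective P.1 + l) '' (D.L.lattice : Set ℂ) := by
    intro z _
    refine Set.mem_iUnion.mpr ⟨⟨D.uniformize z, Set.mem_univ _⟩, ?_⟩
    refine ⟨z - Function.surjInv D.uniformize_surjective (D.uniformize z), ?_, by simp⟩
    rw [SetLike.mem_coe, ← D.uniformize_eq_zero_iff, map_sub, Function.surjInv_eq D.uniformize_surjective, sub_self]
  have huniv : (Set.univ : Set ℂ).Countable :=
    (Set.countable_iUnion fun P => hlat.image _).mono hcover
  exact Cardinal.not_countable_real (by simpa using huniv.preimage Complex.ofReal_injective)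

/-! ### E-an-46: `3 ∣ deg φ_D` when the cusp `1/M` maps to `O` -/

/-- **E-an-46 `ThreeDvdModularDegreeOfCuspImageZero` HOLDS** (cell `bsd-f2-manin`, an g11 MEMO-an §55; refuter-1 §R46 B.5
«THEOREM-candidate by fibre counting on `deg_spec`»; «not in print — explains the surplus of `3 ∣ deg φ` at `4 ∥ N` observed by
Watkins 2002 §4»).  `N = 4M`, `M` odd, ANY parametrisation datum `D` of ANY `W`: if `φ_D([1/M]) = O` then `3 ∣ deg φ_D`.

Proof.  `φ_D ∘ τ₃ = φ_D + φ_D([1/M]) = φ_D` for the order-`3` automorphism `τ₃ = w(4)·t` of `Y₀(4M)` (`φ_tau3_smul`); so on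
each fibre `{y ∈ Y₀(4M) : φ_D(y) = P}` the map `y ↦ τ₃ y` is a permutation `σ` with `σ³ = 1` (`(w(4)t)³ = 64γ₀`).  The points
of `ℍ` whose orbit is FIXED by `τ₃` form a COUNTABLE set (`countable_setOf_exists_gamma_smul_eq_tau3_smul`: countably many
`γ`, and `γ z = τ₃ z` has at most one solution since `γ⁻¹τ₃` is never scalar), while `E(ℂ)` is uncountable; so some `P` avoids
both their images and the finite exceptional set of `deg_spec`.  On that fibre `σ` is fixed-point free of order `3`, hence
(`Equiv.Perm.card_fixedPoints_modEq`, `p = 3`) the fibre cardinality `deg φ_D` is `≡ 0 (mod 3)`.  No Riemann–Hurwitz, no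
finiteness of fixed points, no quotient curve.  BSD is not proved by this; Manin's conjecture is not proved by this. -/
theorem threeDvdModularDegreeOfCuspImageZero_holds : ThreeDvdModularDegreeOfCuspImageZero := by
  intro W _ M _ hM D h0
  classical
  set τ₃ : GL (Fin 2) ℝ := glCast (atkinLehnerW (4 * M) 4 : GL (Fin 2) ℚ) * glCast (halfTranslateGL : GL (Fin 2) ℚ)
    with hτ₃
  -- the countable set of `τ₃`-fixed orbits and the exceptional set of points
  set F : Set ℍ := {z : ℍ | ∃ γ : Gamma0 (4 * M), γ • z = τ₃ • z} with hF
  have hFc : F.Countable := countable_setOf_exists_gamma_smul_eq_tau3_smul hM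
  set Bad : Set (W.baseChange ℂ).toAffine.Point := {P | D.fiberOrbitCount P ≠ D.modularDegree} ∪ D.φ '' F with hBad
  have hBadc : Bad.Countable := D.finite_setOf_fiberOrbitCount_ne.countable.union (hFc.image _)
  obtain ⟨P, hP⟩ : ∃ P, P ∉ Bad := by
    by_contra hall
    simp only [not_exists, not_not] at hall
    exact not_countable_univ_points D (hBadc.mono fun P _ => hall P)
  have hcount : D.fiberOrbitCount P = D.modularDegree := by
    by_contra h
    exact hP (Or.inl h)
  have hPF : ∀ z : ℍ, D.φ z = P → z ∉ F := fun z hz hzF => hP (Or.inr ⟨z, hzF, hz⟩)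
  -- the fibre over `P` in `Y₀(4M)` and the permutation induced by `τ₃`
  set S := {y : Y0 (4 * M) // ∃ τ : ℍ, Y0.mk (4 * M) τ = y ∧ D.φ τ = P} with hS
  have hcardS : Nat.card S = D.modularDegree := hcount
  haveI : Finite S := Nat.finite_of_card_ne_zero (by rw [hcardS]; exact D.deg_pos.ne')
  letI : Fintype S := Fintype.ofFinite S
  have hnorm : ∀ x ∈ (Gamma0 (4 * M) : Subgroup (GL (Fin 2) ℝ)), τ₃ * x * τ₃⁻¹ ∈ (Gamma0 (4 * M) : Subgroup (GL (Fin 2) ℝ)) :=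
    fun x hx => tau3_mul_mul_inv_mem hM hx
  have hinv : ∀ z : ℍ, D.φ (τ₃ • z) = D.φ z := φ_tau3_smul hM D h0
  let σ : Function.End S := fun y =>
    ⟨Y0.mk (4 * M) (τ₃ • y.2.choose), τ₃ • y.2.choose, rfl, by rw [hinv]; exact y.2.choose_spec.2⟩
  -- `σ` computed on any representative
  have hσ : ∀ (y : S) (τ : ℍ), Y0.mk (4 * M) τ = y.1 → (σ y).1 = Y0.mk (4 * M) (τ₃ • τ) := by
    intro y τ hτ
    show Y0.mk (4 * M) (τ₃ • y.2.choose) = Y0.mk (4 * M) (τ₃ • τ)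
    exact Y0_mk_smul_eq_of_mk_eq hnorm (y.2.choose_spec.1.trans hτ.symm)
  -- `σ³ = 1`
  have hσ3 : σ ^ 3 ^ 1 = 1 := by
    rw [pow_one]
    funext y
    obtain ⟨τ, hτ, -⟩ := y.2
    have h1 := hσ y τ hτ
    have h2 := hσ (σ y) (τ₃ • τ) h1.symm
    have h3 := hσ (σ (σ y)) (τ₃ • τ₃ • τ) h2.symm
    apply Subtype.ext
    show (σ (σ (σ y))).1 = y.1
    rw [h3, Y0_mk_tau3_cube hM τ, hτ]
  -- `σ` has no fixed point on the fibre over `P`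
  haveI : IsEmpty (Function.fixedPoints σ) := by
    refine ⟨fun ⟨y, hy⟩ => ?_⟩
    obtain ⟨τ, hτ, hφ⟩ := y.2
    have h1 := hσ y τ hτ
    rw [Function.mem_fixedPoints_iff] at hy
    rw [hy] at h1
    -- `[τ] = [τ₃ τ]`: the orbit of `τ` is fixed, so `τ ∈ F`, contradicting the choice of `P`
    obtain ⟨γ, hγ⟩ := (Y0.mk_eq_mk_iff (4 * M) _ _).mp (hτ.trans h1).symm
    exact hPF τ hφ ⟨γ, hγ⟩
  have hmod := Equiv.Perm.card_fixedPoints_modEq (p := 3) (n := 1) hσ3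
  rw [Fintype.card_eq_zero (α := ↥(Function.fixedPoints σ)), Nat.ModEq, Nat.zero_mod] at hmod
  change 3 ∣ D.modularDegree
  rw [← hcardS, Nat.card_eq_fintype_card]
  exact Nat.dvd_of_mod_eq_zero hmod

end Summit.BirchSwinnertonDyer.BirchSwinnertonDyer.Theorems.ManinLocalTwoThree

end
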